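import Summits.BirchSwinnertonDyer.Rank1Residual.X11b.BDPRouteOpenInputIntFrame
import Summits.BirchSwinnertonDyer.Rank1Residual.X11b.Three.HsiehDisplayGlue
import Summits.BirchSwinnertonDyer.Rank1Residual.X11b.ChaRoute
import HarnessLib

/-!
# Class X11b, route p2 at `p ≥ 5`: the EXISTENCE conjunct of the `R₀`-free frame form (Cas18 Thm.
# 3.1♭: a BDP element `Q ∈ 𝓞_{ℂ_p}⟦T⟧` with Castella's interpolation property) holds at EVERY p2 datum
# — semistable or not — from HSIEH 2014, Thm. 1 (PUBLISHED) modulo the λ-supply; and H∃♭ may be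
# supplied in Hsieh's normalisation (cell `b2b-bsdres`, sub-cell `multr1-p2`, gen 24)

HONEST FRAMING (cell `b2b-bsdres`, run/shared/lean/b2b/bsd-rank1-residual/, verbatim in every
file): the goal of the cell is to DELETE the COMBINATION-SHAPED residual classes of the
Birch–Swinnerton-Dyer formula for ALL analytic-rank `≤ 1` elliptic curves over `ℚ` — "full BSD
formula for every rank `≤ 1` curve in class `C`" assembled STRICTLY from published theorems — so
that the rank-`≤ 1` remainder becomes exactly the CONSTRUCTION-SHAPED classes, which are TYPED
(missing-input `Prop`s), NOT attempted. This is not "finishing BSD". Sub-cell `multr1-p2` is a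
RESEARCH ROUTE on class X11b (`ClassX11b W p := r_an = 1 ∧ p ≠ 2 ∧ mult(p) ∧ irr(p)`,
`Partition/Rows.lean`); no claim beyond the stated class and loci; X11b's label does not change;
NOTHING is booked by this file.

THEOREMS ONLY (no definition, no named fact, no `sorry`). The PUBLISHED named fact
`hsieh2014_exists_anticyclotomicPAdicLFunction` (Hsieh 2014 Thm. 1, typed by x11b3-lit1 in Hsieh's
frame over `𝓞_{ℂ_p}⟦T⟧`, `Literature/…/AnticyclotomicRankinSelbergPAdicLFunction.lean`) is CONSUMED as
a hypothesis; the λ-supply enters as an explicit HYPOTHESIS whose statement is team x11b3's S24-a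
(`Three.lambdaSupplyAt₃`, a theorem of class field theory in progress there) at a general prime — no
`def … : Prop` is introduced for it (x11b3 R7-59 convention). x11b3's every-`p` glue lemmas of
`Three/HsiehDisplayGlue.lean` (`Three.hsiehInterpolationValue_eq_bdpInterpolationValue_rescale`,
`Three.exists_pos_pow_four_eq`, `Three.hsiehInterpolationValue_const`) are IMPORTED, not restated;
nothing at `p = 3` is touched or claimed.

## Why (gen 24, after `BDPRouteOpenInputIntFrame.lean`)

Route p2's typed open input is now H∃♭ `P2.IMCDivIntFrameOnTree W p`: per datum ONE frame
`(Ω_K, Ω_p, Q ∈ 𝓞_{ℂ_p}⟦T⟧)` with [3.1♭] Castella's interpolation property `R1.IsBDPLFunctionInt` ∧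
[3.2♭] the value at `𝟙` ∧ [(2.4)♭] the divisibility. In the registry's reading its first conjunct has
a PUBLISHED source only on SEMISTABLE pairs (Cas18 Thms. 3.1–3.2 stand under "`E` semistable";
`thm32_exists_isBDPLFunction_valueAtOne` carries `Semistable W`): on the 1 514 163 NON-semistable
X11b-shape pairs (67 %) all three conjuncts were [Castella 2024] PREPRINT. But route p2's data are
CLASSICAL Heegner data (every `ℓ ∣ N_E` split in `K`), which is exactly the scope of Hsieh 2014,
Thm. 1 (`p` odd, `v_p(N) ≤ 1`, `K` imaginary quadratic with the classical Heegner hypothesis, `p`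
split — automatic here since `p ∣ N_E`; NO semistability), and over the wide receptacle the
`R₀`-descent that team x11b3 must carry at `p = 3` as `Three.HsiehDescentAt₃` is NOT NEEDED. So:

* §1 every-`p` ♭-GLUE (theorems): `intSeries_hasValueAt_C_mul` (values of `c·Q`),
  `isUnit_padicComplexInt_of_norm_eq_one`, and **`exists_isBDPLFunctionInt_of_isHsiehLFunction`**: a
  Hsieh witness `(A, Ω_K, C, Ω_p, Q)` at `p ∣ N` (`0 < A`, `Ω_K ≠ 0`, `‖ι'⁻¹C‖ = 1`) yields the
  Castella-normalised ♭-frame `((16A²/p)^{1/4}·Ω_K, Ω_p, (ι'⁻¹C)⁻¹·Q)` with `R1.IsBDPLFunctionInt` —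
  multr1-p1 GEN 23's item (iii) / x11b3-p7's `exists_isBDPLFunction_of_hsiehDisplay` at a general prime
  with NO `R₀` hypothesis.
* §2 **`P2.exists_isBDPLFunctionInt_of_hsieh2014`** — AT EVERY p2 DATUM (`(E,p)` ∈ X11b, `p ≥ 5`,
  `N = N_E`, `f` the newform of `E`, `K` imaginary quadratic with the classical Heegner hypothesis for
  `N`, anticyclotomic `(κ, γ)`, any embedding datum `ι'` and infinite place `w₀`): Hsieh 2014 Thm. 1 +
  the λ-supply at `(ι', K, κ)` ⟹ `∃ (Ω_K ≠ 0, Ω_p with ‖Ω_p‖ = 1, Q ∈ 𝓞_{ℂ_p}⟦T⟧)` with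
  `R1.IsBDPLFunctionInt p ι' 𝔭_{ι'} κ γ f Ω_K Ω_p Q` — conjunct 3.1♭ of H∃♭, semistable OR NOT. Hsieh's
  hypotheses are discharged from the datum: `p ≠ 2`; `IsNewform0 f`; `p² ∤ N_E` and `p ∣ N_E`
  (multiplicative); `p` split (the Heegner hypothesis AT `p ∣ N_E`); `p ∈ 𝔭_{ι'}` and the
  compatibility clause for every infinite place (`EmbeddingDatumPrime.lean`).
* §3 **`P2.imcDivIntFrameOnTree_of_hsiehFrame`** — H∃♭ SUPPLIED IN HSIEH'S NORMALISATION: if at every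
  datum some Hsieh witness `Q` carries the value at `𝟙` (`R1.BDPValueAtOneIntAt`, invariant under unit
  rescaling) and the divisibility `Ch_Λ(X_ac)·𝓞_{ℂ_p}⟦T⟧ ⊆ (Q)` (an ideal statement, invariant under
  unit rescaling), then `P2.IMCDivIntFrameOnTree W p` — so a refereed one-sided statement about the
  BDP element in EITHER normalisation (Castella's `L_p(f)` or Hsieh's `𝒫_Σ(π,λ)²` / CH18's `ℒ_p(f)`)
  feeds the route.

HONEST READING for the registry (no fact filed, no mark): conjunct 3.1♭ of route p2's open input has
a PUBLISHED source on ALL 2 267 348 X11b-shape pairs at `p ≥ 5` (Hsieh 2014 Thm. 1), modulo the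
λ-supply (class field theory; x11b3 S24-a in progress at `p = 3`, the same statement at every `p`);
what stays PREPRINT on non-semistable pairs is 3.2 (the value at `𝟙`: [cas-split] Thm. 2.11 /
[Castella 2024]) and, everywhere, (2.4). CONDITIONAL; nothing booked; labels UNCHANGED; X11b stays
CONSTRUCTION-SHAPED.

References: [Hsieh2014] M.-L. Hsieh, Doc. Math. 19 (2014) 709–767, Thm. 1 (arXiv:1112.1580 pp. 3–4),
p. 7; [Castella2018] Thm. 3.1, Thm. 3.2 (arXiv:1704.06608 p. 9); [Castella2018Erratum] (2.4);
[CastellaHsieh2018] §3.3; [Castella2024] arXiv:2409.01360 Thm. 3.1.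
-/

noncomputable section

open scoped Classical NumberField

open WeierstrassCurve NumberField IsDedekindDomain Field PowerSeries
open Literature.NumberTheory.EllipticCurves Literature.NumberTheory.EllipticCurves.GreenbergSelmer
open Literature.NumberTheory.EllipticCurves.ModularForms
open Literature.NumberTheory.EllipticCurves.Rank1Residual
open Literature.NumberTheory.EllipticCurves.Rank1Residual.Typed
open Literature.NumberTheory.EllipticCurves.Castella2018
open Literature.NumberTheory.QuadraticFields.Quadratic
open Literature.NumberTheory.GaloisRepresentations Literature.NumberTheory.GaloisCohomology
open Literature.NumberTheory.Automorphic
open Summit.BirchSwinnertonDyer.Rank1Residual.X11b.AcSelmer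
open Summit.BirchSwinnertonDyer.Rank1Residual.X11b.Halves

namespace Summit.BirchSwinnertonDyer.Rank1Residual.X11b

/-! ### §1 Every-`p` ♭-glue: Hsieh's display ⟹ Castella's display over `𝓞_{ℂ_p}⟦T⟧` -/

section Glue

variable {p : ℕ} [Fact p.Prime]

/-- **Values of `c·Q`**: if `Q ∈ 𝓞_{ℂ_p}⟦T⟧` takes the value `v` at `T = x`, then `C(c)·Q` takes the
value `c·v` there (`[T^k](c·Q) = c·[T^k]Q`, `HasSum.mul_left`). [folklore] -/
theorem intSeries_hasValueAt_C_mul (c : 𝓞_ℂ_[p]) {Q : PowerSeries 𝓞_ℂ_[p]} {x v : ℂ_[p]}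
    (h : IntSeries.HasValueAt Q x v) :
    IntSeries.HasValueAt (PowerSeries.C c * Q) x ((c : ℂ_[p]) * v) := by
  unfold IntSeries.HasValueAt at h ⊢
  have h' := h.mul_left ((c : 𝓞_ℂ_[p]) : ℂ_[p])
  have hfun : (fun k : ℕ ↦ ((PowerSeries.coeff k (PowerSeries.C c * Q) : 𝓞_ℂ_[p]) : ℂ_[p]) * x ^ k) =
      (fun k : ℕ ↦ ((c : 𝓞_ℂ_[p]) : ℂ_[p]) * (((PowerSeries.coeff k Q : 𝓞_ℂ_[p]) : ℂ_[p]) * x ^ k)) := by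
    funext k
    rw [PowerSeries.coeff_C_mul, MulMemClass.coe_mul, mul_assoc]
  rw [hfun]
  exact h'

/-- An element of `𝓞_{ℂ_p}` of norm one is a unit of `𝓞_{ℂ_p}` (its inverse has norm one).
[folklore] -/
theorem isUnit_padicComplexInt_of_norm_eq_one {c : 𝓞_ℂ_[p]} (hc : ‖(c : ℂ_[p])‖ = 1) :
    IsUnit c := by
  have hc0 : (c : ℂ_[p]) ≠ 0 := fun h ↦ by simp [h] at hc
  refine isUnit_iff_exists_inv.mpr ⟨⟨(c : ℂ_[p])⁻¹,
    Literature.NumberTheory.LFunctions.Dwork.mem_unitBall.mpr (by rw [norm_inv, hc, inv_one])⟩, ?_⟩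
  exact Subtype.ext (mul_inv_cancel₀ hc0)

variable {K : Type} [Field K] [NumberField K] {N : ℕ}

/-- **Hsieh's display ⟹ Castella's display over the wide receptacle, at a general prime `p ∣ N`**
(multr1-p1 GEN 23 item (iii); x11b3-p7's `Three.exists_isBDPLFunction_of_hsiehDisplay` at every `p`,
with NO `R₀` hypothesis): a Hsieh witness `(A, Ω_K, C, Ω_p, Q)` — `IsHsiehLFunction ι' 𝔭 κ γ f A Ω_K C
Ω_p Q` with `0 < A`, `Ω_K ≠ 0`, `‖ι'⁻¹C‖ = 1` — yields the ♭-frame `(Ω_K₁, Ω_p, c·Q)` with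
`Ω_K₁ = (16A²/p)^{1/4}·Ω_K ≠ 0` (the real monomial `(p/(16A²))^{n}` of Hsieh's archimedean factor and
Steinberg root number absorbed by the complex period, `Three.hsiehInterpolationValue_eq_bdpInterpolationValue_rescale`)
and `c = (ι'⁻¹C)⁻¹ ∈ 𝓞_{ℂ_p}^×` (the `φ`-independent unit constant absorbed by the element), carrying
Castella's interpolation property `R1.IsBDPLFunctionInt p ι' 𝔭 κ γ f Ω_K₁ Ω_p (C(c)·Q)` VERBATIM.
[cite: Hsieh2014, Thm. 1 (arXiv:1112.1580 p. 4)] [cite: Castella2018, Thm. 3.1 (arXiv:1704.06608 p. 9)] -/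
theorem exists_isBDPLFunctionInt_of_isHsiehLFunction (ι' : PadicAlgCl p ≃+* ℂ)
    (𝔭 : HeightOneSpectrum (𝓞 K)) (κ : ZpExtension K p) (γ : Field.absoluteGaloisGroup K) [NeZero N]
    (f : CuspForm (CongruenceSubgroup.Gamma0 N) 2) (hpN : p ∣ N) {A : ℝ} (hA : 0 < A) {ΩK C : ℂ}
    (hΩK : ΩK ≠ 0) (hC : ‖((ι'.symm C : PadicAlgCl p) : ℂ_[p])‖ = 1) (Ωp : ℂ_[p])
    {Q : PowerSeries 𝓞_ℂ_[p]} (hQ : IsHsiehLFunction ι' 𝔭 κ γ f A ΩK C Ωp Q) :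
    ∃ (ΩK₁ : ℂ) (c : 𝓞_ℂ_[p]), ΩK₁ ≠ 0 ∧ ‖(c : ℂ_[p])‖ = 1 ∧
      R1.IsBDPLFunctionInt p ι' 𝔭 κ γ f ΩK₁ Ωp (PowerSeries.C c * Q) := by
  have hp : p.Prime := Fact.out
  -- the real fourth root `c₄ = (16A²/p)^{1/4}`
  obtain ⟨c₄, hc₄, hc₄4⟩ := Three.exists_pos_pow_four_eq (x := 16 * A ^ 2 / p)
    (div_pos (by positivity) (by exact_mod_cast hp.pos))
  have hp0 : (p : ℂ) ≠ 0 := by exact_mod_cast hp.ne_zero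
  have hcC : (c₄ : ℂ) ≠ 0 := Complex.ofReal_ne_zero.mpr hc₄.ne'
  have hc4C : (c₄ : ℂ) ^ 4 = 16 * (A : ℂ) ^ 2 / (p : ℂ) := by
    have := congrArg (fun t : ℝ ↦ (t : ℂ)) hc₄4
    push_cast at this ⊢
    exact this
  -- the unit `c = (ι'⁻¹C)⁻¹`
  set d : ℂ_[p] := ((ι'.symm C : PadicAlgCl p) : ℂ_[p]) with hd
  have hd0 : d ≠ 0 := fun h ↦ by rw [h, norm_zero] at hC; exact zero_ne_one hC
  have hdinv : ‖d⁻¹‖ = 1 := by rw [norm_inv, hC, inv_one]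
  let c : 𝓞_ℂ_[p] := ⟨d⁻¹, Literature.NumberTheory.LFunctions.Dwork.mem_unitBall.mpr hdinv.le⟩
  refine ⟨(c₄ : ℂ) * ΩK, c, mul_ne_zero hcC hΩK, hdinv, ?_⟩
  intro χ n hn hunr hinf r hr hκ
  have hv := hQ χ n hn hunr hinf r hr hκ
  rw [Three.hsiehInterpolationValue_const p f 𝔭 χ n A ΩK C,
    Three.hsiehInterpolationValue_eq_bdpInterpolationValue_rescale hpN hp0 f 𝔭 χ n hA.ne' ΩK (c₄ : ℂ)
      hcC hc4C, map_mul, UniformSpace.Completion.coe_mul] at hv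
  have hv' := intSeries_hasValueAt_C_mul c hv
  convert hv' using 1
  have hcd : ((c : 𝓞_ℂ_[p]) : ℂ_[p]) * d = 1 := inv_mul_cancel₀ hd0
  calc ((ι'.symm (bdpInterpolationValue p f 𝔭 χ n ((c₄ : ℂ) * ΩK)) : PadicAlgCl p) : ℂ_[p]) *
        Ωp ^ (4 * n)
      = (((c : 𝓞_ℂ_[p]) : ℂ_[p]) * d) *
          (((ι'.symm (bdpInterpolationValue p f 𝔭 χ n ((c₄ : ℂ) * ΩK)) : PadicAlgCl p) : ℂ_[p]) *
            Ωp ^ (4 * n)) := by rw [hcd, one_mul]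
    _ = ((c : 𝓞_ℂ_[p]) : ℂ_[p]) *
          (d * ((ι'.symm (bdpInterpolationValue p f 𝔭 χ n ((c₄ : ℂ) * ΩK)) : PadicAlgCl p) : ℂ_[p]) *
            Ωp ^ (4 * n)) := by ring

end Glue

/-! ### §2 Conjunct 3.1♭ of H∃♭ at EVERY p2 datum, from Hsieh 2014 Thm. 1 and the λ-supply -/

section Existence

variable (W : WeierstrassCurve ℚ) [W.IsElliptic] (p : ℕ) [Fact p.Prime]

/-- **Cas18 Thm. 3.1♭ AT EVERY p2 DATUM — semistable or not — from HSIEH 2014, Thm. 1 (PUBLISHED)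
modulo the λ-supply.** For `(E,p)` in X11b with `p ≥ 5`, `N = N_E`, `f` the newform of `E`, `K`
imaginary quadratic satisfying the CLASSICAL Heegner hypothesis for `N` (every `ℓ ∣ N` split — route
p2's fields), an anticyclotomic `ℤ_p`-extension `κ` with topological generator `γ`, an embedding datum
`ι' : ℚ̄_p ≃ ℂ` and an infinite place `w₀` (so `𝔭_{ι'} = primeOfEmbeddingDatum p ι' w₀.embedding`),
GIVEN the λ-supply at `(ι', K, κ)` — an auxiliary Hecke character `λ` of `K`, unitary, of infinity
type `(1, −1)`, trivial on `𝔸_ℚ^×`, unramified outside `p`, with a `p`-adic avatar `r_λ` through `κ`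
(x11b3's S24-a statement at the prime `p`; class field theory; a HYPOTHESIS here, no def) —: THERE IS
a ♭-frame `(Ω_K ≠ 0, Ω_p with ‖Ω_p‖ = 1, Q ∈ 𝓞_{ℂ_p}⟦T⟧)` with Castella's interpolation property
`R1.IsBDPLFunctionInt p ι' 𝔭_{ι'} κ γ f Ω_K Ω_p Q`, i.e. conjunct 3.1♭ of `P2.IMCDivIntFrameOnTree W p`
at the datum. Hsieh's hypotheses from the datum: `p ≠ 2`; `IsNewform0 f`; `p² ∤ N_E`, `p ∣ N_E`
(multiplicative, `not_sq_dvd_conductorNorm_of_mult` / `dvd_conductorNorm_of_mult`); `p` SPLIT in `K`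
(the Heegner hypothesis at `p ∣ N_E`); `p ∈ 𝔭_{ι'}`, the compatibility clause at every infinite place
(`forall_mem_primeOfEmbeddingDatum_iff`); then §1's glue. NO semistability, NO `R₀`-descent.
CONDITIONAL on the named fact `hH` (published) and the λ-supply; nothing booked.
[cite: Hsieh2014, Thm. 1 (arXiv:1112.1580 pp. 3–4)] [cite: Castella2018, Thm. 3.1 (arXiv:1704.06608 p. 9)] -/
theorem P2.exists_isBDPLFunctionInt_of_hsieh2014 (hH : hsieh2014_exists_anticyclotomicPAdicLFunction)
    {N : ℕ} [NeZero N] {K : Type} [Field K] [NumberField K]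
    {f : CuspForm (CongruenceSubgroup.Gamma0 N) 2} (hnf : IsNewformOf W f) (hX : ClassX11b W p)
    (hp5 : 5 ≤ p) (hN : W.conductorNorm ℤ = N) (hK : IsImaginaryQuadratic K)
    (hHN : SatisfiesHeegnerHypothesis N K) (κ : ZpExtension K p) (hκ : κ.IsAnticyclotomic)
    (γ : Field.absoluteGaloisGroup K) [hγ : Fact (κ.IsTopGenerator γ)] (ι' : PadicAlgCl p ≃+* ℂ)
    (w₀ : InfinitePlace K)
    -- the λ-supply at `(ι', K, κ)`: x11b3's S24-a statement at the prime `p` (HYPOTHESIS, no def)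
    (hsup : ∃ (lam : HeckeCharacter K) (rlam : FramedGaloisRep K (PadicAlgCl p) 1),
      lam.IsUnitary ∧ lam.HasInfinityType (fun _ ↦ (1 : ℤ)) (fun _ ↦ (-1 : ℤ)) ∧
      (∀ x : ideleGroup ℚ, lam (AdeleRing.ideleBaseChange ℚ K x) = 1) ∧
      (∀ v : HeightOneSpectrum (𝓞 K), ((p : ℕ) : 𝓞 K) ∉ v.asIdeal → lam.IsUnramifiedAt v) ∧
      IsPAdicAvatarOf ι' lam rlam ∧ FactorsThroughZp κ rlam) :
    ∃ (ΩK : ℂ) (Ωp : ℂ_[p]) (Q : PowerSeries 𝓞_ℂ_[p]), ΩK ≠ 0 ∧ ‖Ωp‖ = 1 ∧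
      R1.IsBDPLFunctionInt p ι' (primeOfEmbeddingDatum p ι' w₀.embedding) κ γ f ΩK Ωp Q := by
  obtain ⟨lam, rlam, hunit, hinfl, hAQ, hunrl, havl, hfacl⟩ := hsup
  have hp : p.Prime := Fact.out
  have hp2 : p ≠ 2 := by omega
  have hmult : Mult W p := hX.2.2.1
  have h9 : ¬ p ^ 2 ∣ N := hN ▸ not_sq_dvd_conductorNorm_of_mult W p hmult
  have hpN : p ∣ N := hN ▸ dvd_conductorNorm_of_mult hmult
  have hsplit : ((Ideal.span {(p : ℤ)}).primesOver (𝓞 K)).ncard = 2 := hHN p hp hpN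
  obtain ⟨A, ΩK, C, Ωp, Q, hA, hΩK, hC, hΩp, hQ⟩ :=
    hH ι' K (primeOfEmbeddingDatum p ι' w₀.embedding) κ γ f lam rlam hp2 hnf.1 h9 hK hsplit
      (natCast_mem_primeOfEmbeddingDatum p ι' w₀.embedding)
      (forall_mem_primeOfEmbeddingDatum_iff p ι' hK w₀) hHN hunit hinfl hAQ hunrl havl hfacl hκ hγ.out
  obtain ⟨ΩK₁, c, hΩK₁, -, hBDP⟩ :=
    exists_isBDPLFunctionInt_of_isHsiehLFunction ι' _ κ γ f hpN hA hΩK hC Ωp hQ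
  exact ⟨ΩK₁, Ωp, _, hΩK₁, hΩp, hBDP⟩

/-- **The same at the data of `P2.IMCDivIntFrameOnTree W p` literally** (with `f = Dt.f` the newform of
the parametrisation datum and the shape's binders): conjunct 3.1♭ of H∃♭ is SATISFIABLE at every datum
of route p2's open input, from Hsieh 2014 Thm. 1 and the λ-supply — route p2 does not ask, on any
pair, for an object without a published construction; what it asks beyond print is the VALUE at `𝟙`
off the semistable pairs and the DIVISIBILITY (2.4). CONDITIONAL on `hH` and the λ-supply; nothing
booked. [cite: Hsieh2014, Thm. 1 (arXiv:1112.1580 pp. 3–4)] [cite: Castella2018, Thm. 3.1 (arXiv:1704.06608 p. 9)] -/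
theorem P2.exists_isBDPLFunctionInt_datum_of_hsieh2014
    (hH : hsieh2014_exists_anticyclotomicPAdicLFunction) {N : ℕ} [NeZero N] {K : Type} [Field K]
    [NumberField K] (Dt : ModularParametrizationData W N) (hX : ClassX11b W p) (hp5 : 5 ≤ p)
    (hN : W.conductorNorm ℤ = N) (hK : IsImaginaryQuadratic K) (hHN : SatisfiesHeegnerHypothesis N K)
    (κ : ZpExtension K p) (hκ : κ.IsAnticyclotomic) (γ : Field.absoluteGaloisGroup K)
    [Fact (κ.IsTopGenerator γ)] (ι' : PadicAlgCl p ≃+* ℂ) (w₀ : InfinitePlace K)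
    (hsup : ∃ (lam : HeckeCharacter K) (rlam : FramedGaloisRep K (PadicAlgCl p) 1),
      lam.IsUnitary ∧ lam.HasInfinityType (fun _ ↦ (1 : ℤ)) (fun _ ↦ (-1 : ℤ)) ∧
      (∀ x : ideleGroup ℚ, lam (AdeleRing.ideleBaseChange ℚ K x) = 1) ∧
      (∀ v : HeightOneSpectrum (𝓞 K), ((p : ℕ) : 𝓞 K) ∉ v.asIdeal → lam.IsUnramifiedAt v) ∧
      IsPAdicAvatarOf ι' lam rlam ∧ FactorsThroughZp κ rlam) :
    ∃ (ΩK : ℂ) (Ωp : ℂ_[p]) (Q : PowerSeries 𝓞_ℂ_[p]), ΩK ≠ 0 ∧ ‖Ωp‖ = 1 ∧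
      R1.IsBDPLFunctionInt p ι' (primeOfEmbeddingDatum p ι' w₀.embedding) κ γ Dt.f ΩK Ωp Q :=
  P2.exists_isBDPLFunctionInt_of_hsieh2014 W p hH Dt.isNewformOf hX hp5 hN hK hHN κ hκ γ ι' w₀ hsup

end Existence

/-! ### §3 H∃♭ supplied in Hsieh's normalisation -/

section HsiehNormalisation

variable {W : WeierstrassCurve ℚ} [W.IsElliptic] [W.IsGloballyMinimal] {p : ℕ} [Fact p.Prime]

/-- **H∃♭ MAY BE SUPPLIED IN HSIEH'S NORMALISATION.** If at every datum of `P2.IMCDivIntFrameOnTree W p`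
there is a Hsieh witness `(A, Ω_K, C, Ω_p, Q)` (`0 < A`, `Ω_K ≠ 0`, `‖ι'⁻¹C‖ = 1`, `‖Ω_p‖ = 1`,
`IsHsiehLFunction ι' 𝔭_{ι'} κ γ f_{Dt} A Ω_K C Ω_p Q`) whose element `Q` carries the value at `𝟙`
(`R1.BDPValueAtOneIntAt W p e P' Q a_p` — "up to a unit of norm `1`", invariant under rescaling `Q`
by a unit) and the divisibility `Ch_Λ(X_ac^∅(E[p^∞]))·𝓞_{ℂ_p}⟦T⟧ ⊆ (Q)` (an IDEAL statement,
invariant under rescaling by a unit), then H∃♭ holds: §1's glue turns the witness into the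
Castella-normalised frame `((16A²/p)^{1/4}Ω_K, Ω_p, c·Q)`, `c = (ι'⁻¹C)⁻¹ ∈ 𝓞_{ℂ_p}^×`, with the
same value shape (`u ↦ c·u`) and the same ideal (`(c·Q) = (Q)`). So a refereed ONE-SIDED statement
about the BDP element in EITHER normalisation — Castella's `L_p(f)` or Hsieh's `𝒫_Σ(π,λ)²` /
Castella–Hsieh's `ℒ_p(f)` — feeds route p2. CONDITIONAL on the hypothesis (open); nothing booked.
[cite: Hsieh2014, Thm. 1 (arXiv:1112.1580 pp. 3–4)] [cite: Castella2018, Thms. 3.1–3.2 (arXiv:1704.06608 p. 9)]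
[cite: Castella2018Erratum, (2.4) (p. 4)] -/
theorem P2.imcDivIntFrameOnTree_of_hsiehFrame
    (hF : ∀ (N : ℕ) [NeZero N] (K : Type) [Field K] [NumberField K]
      (Dt : ModularParametrizationData W N) (H : HeegnerDatum N (NumberField.discr K)) (ι : K →+* ℂ)
      (P : (W.baseChange K).toAffine.Point),
      ClassX11b W p → 5 ≤ p → Surj W p → W.conductorNorm ℤ = N → IsImaginaryQuadratic K →
      Odd (NumberField.discr K) → ¬ (p : ℤ) ∣ NumberField.discr K → ¬ p ∣ Units.torsionOrder K →
      SatisfiesHeegnerHypothesis N K →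
      (W.quadraticTwist (NumberField.discr K : ℚ)).entireLFunction 1 ≠ 0 →
      WeierstrassCurve.Affine.Point.map ι.toRatAlgHom P = heegnerPointComplex Dt H →
      ¬ (p : ℤ) ∣ Dt.c → ¬ IsOfFinAddOrder P →
      ∀ (κ : ZpExtension K p), κ.IsAnticyclotomic →
        ∀ (γ : Field.absoluteGaloisGroup K) [Fact (κ.IsTopGenerator γ)]
          (ι' : PadicAlgCl p ≃+* ℂ) (w₀ : InfinitePlace K) (P' : (W.baseChange K).toAffine.Point),
          WeierstrassCurve.Affine.Point.map w₀.embedding.toRatAlgHom P' = heegnerPointComplex Dt H →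
          ∀ (e : K →+* ℚ_[p]),
            (∀ k : 𝓞 K, k ∈ (primeOfEmbeddingDatum p ι' w₀.embedding).asIdeal ↔ ‖e (k : K)‖ < 1) →
            ∃ (A : ℝ) (ΩK C : ℂ) (Ωp : ℂ_[p]) (Q : PowerSeries 𝓞_ℂ_[p]),
              0 < A ∧ ΩK ≠ 0 ∧ ‖((ι'.symm C : PadicAlgCl p) : ℂ_[p])‖ = 1 ∧ ‖Ωp‖ = 1 ∧
              IsHsiehLFunction ι' (primeOfEmbeddingDatum p ι' w₀.embedding) κ γ Dt.f A ΩK C Ωp Q ∧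
              R1.BDPValueAtOneIntAt W p e P' Q (W.LFunction p) ∧
              (XAc.charIdeal (W.baseChange K) p κ (primeOfEmbeddingDatum p ι' w₀.embedding) ∅ γ).map
                (PowerSeries.map (R1.toCpInt p)) ≤ Ideal.span {Q}) :
    P2.IMCDivIntFrameOnTree W p := by
  intro N _ K _ _ Dt H ιK P hX h5 hs hN hK hodd hpd hμ hHN hLt hP hc hPinf κ hκ γ _ ι' w₀ P' hP' e he
  obtain ⟨A, ΩK, C, Ωp, Q, hA, hΩK, hC, hΩp, hQ, ⟨u, hu1, hu⟩, hdiv⟩ :=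
    hF N K Dt H ιK P hX h5 hs hN hK hodd hpd hμ hHN hLt hP hc hPinf κ hκ γ ι' w₀ P' hP' e he
  have hpN : p ∣ N := hN ▸ dvd_conductorNorm_of_mult hX.2.2.1
  obtain ⟨ΩK₁, c', hΩK₁, hc', hBDP⟩ :=
    exists_isBDPLFunctionInt_of_isHsiehLFunction ι' _ κ γ Dt.f hpN hA hΩK hC Ωp hQ
  refine ⟨ΩK₁, Ωp, PowerSeries.C c' * Q, hΩK₁, hΩp, hBDP, ?_, ?_⟩
  · -- the value shape: `u ↦ c'·u`, still of norm `1`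
    refine ⟨((c' : 𝓞_ℂ_[p]) : ℂ_[p]) * u, by rw [norm_mul, hc', hu1, one_mul], ?_⟩
    have h := intSeries_hasValueAt_C_mul c' hu
    rwa [← mul_assoc] at h
  · -- the ideal: `(c'·Q) = (Q)` for the unit `c'`
    rwa [Ideal.span_singleton_mul_left_unit
      ((isUnit_padicComplexInt_of_norm_eq_one hc').map PowerSeries.C) Q]

end HsiehNormalisation

/-! ### §4 (gen 24 append) Every ODD prime: the `5 ≤ p` of §2 is not used -/

section OddPrime

variable (W : WeierstrassCurve ℚ) [W.IsElliptic] (p : ℕ) [Fact p.Prime]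

/-- **Cas18 Thm. 3.1♭ at every X11b datum at ANY (odd) prime, from Hsieh 2014 Thm. 1 and the
λ-supply** — §2's `P2.exists_isBDPLFunctionInt_of_hsieh2014` WITHOUT `5 ≤ p`: the only parity input
Hsieh's theorem needs is `p ≠ 2`, which `ClassX11b W p` carries. So the statement serves the `p = 3`
team's X11b@3 pairs as well, in ♭ currency (over `𝓞_{ℂ_3}⟦T⟧` NO `R₀`-descent — team x11b3's
`Three.HsiehDescentAt₃` — is asked; their `R₀`-typed H1 `Three.BDPExistsAt₃` is a different, stronger
target and is NOT claimed here). CONDITIONAL on the named fact `hH` (published) and the λ-supply at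
`(ι', K, κ)` (x11b3 S24-a's statement at the prime `p`, a hypothesis); nothing booked; nothing at
`p = 3` is consumed or restated. [cite: Hsieh2014, Thm. 1 (arXiv:1112.1580 pp. 3–4)]
[cite: Castella2018, Thm. 3.1 (arXiv:1704.06608 p. 9)] -/
theorem P2.exists_isBDPLFunctionInt_of_hsieh2014_odd
    (hH : hsieh2014_exists_anticyclotomicPAdicLFunction) {N : ℕ} [NeZero N] {K : Type} [Field K]
    [NumberField K] {f : CuspForm (CongruenceSubgroup.Gamma0 N) 2} (hnf : IsNewformOf W f)
    (hX : ClassX11b W p) (hN : W.conductorNorm ℤ = N) (hK : IsImaginaryQuadratic K)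
    (hHN : SatisfiesHeegnerHypothesis N K) (κ : ZpExtension K p) (hκ : κ.IsAnticyclotomic)
    (γ : Field.absoluteGaloisGroup K) [hγ : Fact (κ.IsTopGenerator γ)] (ι' : PadicAlgCl p ≃+* ℂ)
    (w₀ : InfinitePlace K)
    (hsup : ∃ (lam : HeckeCharacter K) (rlam : FramedGaloisRep K (PadicAlgCl p) 1),
      lam.IsUnitary ∧ lam.HasInfinityType (fun _ ↦ (1 : ℤ)) (fun _ ↦ (-1 : ℤ)) ∧
      (∀ x : ideleGroup ℚ, lam (AdeleRing.ideleBaseChange ℚ K x) = 1) ∧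
      (∀ v : HeightOneSpectrum (𝓞 K), ((p : ℕ) : 𝓞 K) ∉ v.asIdeal → lam.IsUnramifiedAt v) ∧
      IsPAdicAvatarOf ι' lam rlam ∧ FactorsThroughZp κ rlam) :
    ∃ (ΩK : ℂ) (Ωp : ℂ_[p]) (Q : PowerSeries 𝓞_ℂ_[p]), ΩK ≠ 0 ∧ ‖Ωp‖ = 1 ∧
      R1.IsBDPLFunctionInt p ι' (primeOfEmbeddingDatum p ι' w₀.embedding) κ γ f ΩK Ωp Q := by
  obtain ⟨lam, rlam, hunit, hinfl, hAQ, hunrl, havl, hfacl⟩ := hsup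
  have hp : p.Prime := Fact.out
  have hmult : Mult W p := hX.2.2.1
  have h9 : ¬ p ^ 2 ∣ N := hN ▸ not_sq_dvd_conductorNorm_of_mult W p hmult
  have hpN : p ∣ N := hN ▸ dvd_conductorNorm_of_mult hmult
  obtain ⟨A, ΩK, C, Ωp, Q, hA, hΩK, hC, hΩp, hQ⟩ :=
    hH ι' K (primeOfEmbeddingDatum p ι' w₀.embedding) κ γ f lam rlam hX.2.1 hnf.1 h9 hK (hHN p hp hpN)
      (natCast_mem_primeOfEmbeddingDatum p ι' w₀.embedding)
      (forall_mem_primeOfEmbeddingDatum_iff p ι' hK w₀) hHN hunit hinfl hAQ hunrl havl hfacl hκ hγ.out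
  obtain ⟨ΩK₁, c, hΩK₁, -, hBDP⟩ :=
    exists_isBDPLFunctionInt_of_isHsiehLFunction ι' _ κ γ f hpN hA hΩK hC Ωp hQ
  exact ⟨ΩK₁, Ωp, _, hΩK₁, hΩp, hBDP⟩

end OddPrime

end Summit.BirchSwinnertonDyer.Rank1Residual.X11b

end
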